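import Literature.MathematicalPhysics.QuantumFieldTheory.Balaban1983to89.B12Eq443LatticeMoments
import Literature.MathematicalPhysics.QuantumFieldTheory.Balaban1983to89.B5Eq166GaussDeltaK
import Literature.MathematicalPhysics.QuantumFieldTheory.Balaban1983to89.B5Kernel166Decay

/-!
# B12 (4.40) p. 291 ON THE TORUS: the (1.65) operator `Δ_j` of record IS the convolution by the periodised
# `ℤ^{d+1}`-kernel `Δ_{j,μν}(x)` of the printed momentum representation (4.41) — entries, reality, (4.40), the tail

statement-level skeleton of published theorems with citation tags; proofs where landed; nothing here is a
claim about the Yang–Mills mass gap.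

Sources: T. Bałaban, *Renormalization group approach to lattice gauge field theories. I*, Commun. Math. Phys. **109**
(1987) 249–301 (`Balaban1987RG1`, "B12"), pp. 290–291 [PDF 42–43] (held: `lit read
paper:balaban1987-cmp109-rg-i-small-field --pages 42-43`); T. Bałaban, *Propagators and renormalization
transformations for lattice gauge theories. I*, Commun. Math. Phys. **95** (1984) 17–40 (`Balaban1984PropagatorsI`,
"B5" = B12's reference [10]), (1.19) p. 20, (1.29) p. 23, (1.65)–(1.66) p. 29, p. 36 ll. 20–23.  PDF held: yes (both).
Unit `lit-balaban` (HOME `run/shared/lean/pub/lit-balaban/`), Phase-2 proof seat p10 (gen 9); WHAT IS REPRODUCED =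
SKELETON row `B12.Eq4.38-4.40`, member **(4.40)**, for the typed `Δ_j` of rows `B12.Eq4.41` / `B12.Eq4.42-4.45` (this
seat's lineage: `B12Eq441SymbolExpansion.symbDeltaJ`, `B12Eq443LatticeMoments.kerDeltaJ`) and the (1.19)/(1.65) torus
operator of record of rows `B5.Eq1.66` / `B5.Eq1.19` (`Beta.BlockEffectiveAction.DelK`, `B5Eq114Gauss.DeltaK`).

## What the paper prints (verbatim, B12 pp. 290–291)

p. 290: «If we replace H_j(□₀) by H_j with free boundary conditions, then the difference H_j(□₀) − H_j restricted to
X × supp ζ̃_□ yields the factor B₀exp(−δ₀M(L^jη)⁻¹) in a bound of the corresponding expression. (…) Next, we extend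
summations over y to the whole lattice Z⁴. (…) This gives again the exponentially small coefficients.»
p. 291: «Replacing the functions H_j(□₀) by H_j and summing over all □′ ∈ ξZ⁴ yields the following expression, as the
expression corresponding to (4.37)
  β_j(g_{j−1}) ⟨∂^ξ H_j, ∂^ξ H_j⟩ = β_j(g_{j−1})Δ_j,   (4.40)
where Δ_j is given by the explicit formula (1.66) [10]. (…) The function Δ_{j,μν}(x − y) in the momentum
representation of (1.66) has the following expansion around 0: Δ̃_{j,μν}(p′) = Δ₀(p′)δ_{μν} − ∂̄¹_μ(p′)∂¹_ν(p′) + (terms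
of higher order in p′),   (4.41)».
[10] (1.65) p. 29: «The action Δ_k is thus defined by ⟨B, Δ_kB⟩ = ⟨∂H_kB, ∂H_kB⟩.»; (1.29) p. 23: «f̃(p) =
Σ_{x∈T′_η} η^d e^{−ip·x} f(x), (…) f(x) = (2π)^{−d} Σ_{p∈T̃′_η} (Π_μ π/L′_μ) e^{ix·p} f̃(p)»; p. 36 ll. 20–23: «relating G on
the torus to G on the whole lattice ηZ^d in the usual way».

## What this module proves (kernel-checked; 0 sorry; no `Prop` fact; three bookkeeping `def`s with bodies)

THE OBJECTS.  On the unit torus `T = Π_μ ℤ/M_μ` (`B5Prop11Plancherel.Tor M`, dual torus the same set, `p′ = sOf M p`,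
characters `chi M p z = e^{ip′·z}`): `torKer n M μ ν z := |T|⁻¹ Σ_p Δ̃_{j,μν}(p′) e^{ip′·z}` — the inverse DFT ((1.29))
of the `(μ,ν)` entry of this lineage's typed symbol `symbDeltaJ n` (= the matrix symbol of the PRINTED third
expression of (1.66), `B12Eq441SymbolExpansion.formDk_eq_symb`; `n = L^j`); `symbMat` (fibrewise multiplication by the
transposed symbol) and `kerMat := Uᴴ·symbMat·U` (`U = dftV M`, the componentwise unitary DFT).  The operator OF RECORD is
NOT redefined: it is `Beta.BlockEffectiveAction.DelK n hn M a ha` (the (1.65) matrix `n^{−d}H_kᴴ(∂*∂)H_k = (Q_kGQ_k*)⁻¹ −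
a`), identified with the (1.19) Gaussian covariance `B5Eq114Gauss.DeltaK` by p21's `B5Eq166GaussDeltaK.cplx_DeltaK`.

§1 (any dimension `d`, every `n ≥ 1`, every period vector, every admissible `a`).
* `conj_symbDeltaJ` (the symbol is Hermitian), `formDk_eq_symb_complex` (the typed (1.66) as a COMPLEX identity
  `formDk n M B = Σ_pΣ_{μν} B̃_μ Δ̃_{j,μν} conj B̃_ν`), `star_dotProduct_kerMat_mulVec` (`Bᴴ·kerMat·B = formDk n M B` for
  every complex `B`), `kerMat_apply` (`kerMat_{(x,μ),(y,ν)} = torKer ν μ (x − y)`).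
* **`DelK_eq_kerMat`**, **`DelK_apply`**: `(Δ_k)_{(x,μ),(y,ν)} = torKer n M ν μ (x − y) = |T|⁻¹Σ_p Δ̃_{j,νμ}(p′)e^{ip′·(x−y)}`
  — from `B5Hk163Form166.DelK_form_eq_formDk` (`Bᴴ·Δ_k·B = formDk` for complex `B`) and COMPLEX POLARIZATION (a complex
  matrix is determined by `B ↦ Bᴴ·A·B`; Mathlib `ext_inner_map`).
* §1b: **`torKer_im`** (the kernel is REAL — `B6Cov2156TorusDelK.isReal_DelK`), `torKer_symm` (`K_{μν}(z) = K_{νμ}(−z)`),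
  `DelK_apply'` (`(Δ_k)_{(x,μ),(y,ν)} = torKer μ ν (y − x)`); for the (1.19) operator of record on real fields
  **`DeltaK_apply_eq_sum`** (`(Δ_kB)(x,μ) = Σ_{y,ν} K_{νμ}(x − y)B(y,ν)`), **`inner_DeltaK_eq_sum`** (`⟨B,Δ_kB⟩ =
  Σ_{x,μ,y,ν} B(x,μ)K_{νμ}(x−y)B(y,ν)`) and **`eq440_torus`** — (4.40): `2S^η(A) = ⟨∂A,∂A⟩` for the Landau-gauge minimiser
  `A ∈ B5Eq165DeltaK.landauMin L M k B` (= `H_kB`, [10] (1.63)/(1.65), p16's `eq165`) EQUALS that kernel form.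
§2 (dimension `d + 1`, the lineage's `ℤ^{d+1}` convention).  **`torKer_toT_eq_tsum`**: `torKer n M μ ν x̄ =
  Σ_{m∈ℤ^{d+1}} Δ_{j,μν}(x + (M_im_i)_i)` with `Δ_{j,μν} = B12Eq443LatticeMoments.kerDeltaJ n μ ν` = `(2π)^{−(d+1)}∫
  Δ̃_{j,μν}(p′)e^{ip′·x}dp′` — Poisson summation, pv17's `B4TorusKernel.MultiPeriod.torusKernel_descend_eq` at the strip-regular
  continuation `symbC` (`torKer_toT_eq_torusKernel`, `symbC_grid_eq`: the two grid conventions `[−π,π)`/`(−π,π]` agree by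
  face matching); **`DelK_apply_eq_tsum`** / `DelK_apply_eq_tsum'`: `(Δ_k)_{(x̄,μ),(ȳ,ν)} = Σ_m Δ_{j,νμ}(x − y + Mm) =
  Σ_m Δ_{j,μν}(y − x + Mm)` — THE (1.65)/(1.19) TORUS OPERATOR OF RECORD IS THE PERIODISATION OF THE `ℤ^{d+1}` OPERATOR
  `Δ_j` OF (4.40)/(4.41); `summable_kerDeltaJ_translate`.
§3 (p. 290 «extend summations … to the whole lattice Z⁴»).  **`norm_torKer_toT_sub_kerDeltaJ_le`** /
  **`norm_DelK_sub_kerDeltaJ_le`**: if every period is `≥ R` and `2|x − y|_∞ < R`, then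
  `‖(Δ_k)_{(x̄,μ),(ȳ,ν)} − Δ_{j,νμ}(x − y)‖ ≤ MC · e^{−κ₁₆₆R/4} · periodConst(κ₁₆₆/2, d)` — constants of the lineage
  (`B12Eq443LatticeMoments.MC`, `B5Symbol166Strip.kappa166`, `B4TorusKernel.periodConst`) depending on `d` only: uniform
  in `j` and in the torus.

## Index-order note (read before citing)

With [10] (1.29) (`f̃(p) = Σ_x e^{−ip·x}f(x)`) the matrix symbol `σ` of `Δ_k` in the sense `(Δ_kB)~_μ = Σ_ν σ_{μν}B̃_ν` is
`σ_{μν} = Δ̃_{j,νμ} = conj Δ̃_{j,μν}`, the TRANSPOSE (= complex conjugate, `conj_symbDeltaJ`) of the printed matrix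
(4.41) as typed in `symbDeltaJ` (which transcribes the display literally, `∂̄ = conj`): `DelK_apply` carries `torKer ν μ
(x − y)`, equivalently `torKer μ ν (y − x)` (`DelK_apply'`).  For the quadratic form (4.40) and for (4.42)–(4.45) this is
immaterial (Hermitian symbol, real kernel, `Σ_x Δ(x)` / second moments even); it matters only for statements about
single off-diagonal entries, which the paper does not make.

## What is NOT claimed

(1) `U = 1`, `m² = 0`, the unit torus with arbitrary period vector, as in the whole B5/B12 lineage; nothing on a
background field.  (2) The p. 290 difference `H_j(□₀) − H_j` (local versus global minimiser, the factor
`B₀exp(−δ₀M(L^jη)⁻¹)`) is NOT typed here — §3 quantifies only the torus-versus-`ℤ^{d+1}` periodisation tail of the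
GLOBAL operator's kernel; the restriction of the `y`-sums to `supp ζ̃_□` is this lineage's `B12Eq442DeltaJ` §8.  (3) No
constant is Bałaban's.  NEAREST TREE NEIGHBOURS (searched): `B5Kernel166Decay` (b05: the bond-basis polarization matrix
`B6Cov2156Torus.deltaPol` of the (1.66) FORM as a signed sum of FOUR torus kernels `ksum` of the pieces
`½w·conj ∂¹_a·∂¹_b`, and their decay) and `B6Cov2156TorusDelK.deltaPol_eq_DelK` — together they give the decay of the
entries of `Δ_k`; the present file identifies the entries with ONE kernel, the inverse DFT / periodisation of the typed
(4.41) symbol and `ℤ^{d+1}`-kernel of this lineage, which those files do not mention; no statement is duplicated.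
Value = kernel certificate that the torus operator of (1.19)/(1.65) and the `ℤ^{d+1}` objects of (4.40)/(4.41) typed in
gens 6–8 are one thing up to periodisation; NOT summit progress.
-/

noncomputable section

namespace Literature.MathematicalPhysics.QuantumFieldTheory.Balaban1983to89.B12Eq440TorusKernel

open scoped BigOperators ComplexConjugate Real Matrix InnerProductSpace
open Finset Complex Matrix
open B4Strip (ofRealVec)
open B4ContourShift (BZ StripRegular latticeKernel supNorm abs_le_supNorm supNorm_nonneg)
open B4TorusKernel (descend descendC descendC_apply face_match rep_mem periodConst)
open B4TorusKernel.MultiPeriod (gridPt torusSum torusKernel translate torusKernel_descend_eq)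
open B5Prop11Plancherel (Tor chi dft dftV sOf conj_chi chi_add_right chi_neg_neg abs_sOf_le dftV_apply
  dftV_mul_star star_dftV_mul)
open B5Prop11Fiber (d1Sym)
open B5Bounds167Lattice (w166 comp hat curlHat formDk dftV_mulVec_apply)
open B5Symbol166Strip (kappa166 kappa166_pos MW_pos)
open B12Eq441SymbolExpansion (symbW symbDeltaJ polarization formDk_eq_symb)
open B12Eq443SymbolHessian (symbC symbC_ofReal)
open B12Eq443LatticeMoments (kerDeltaJ MC stripRegular_symbC norm_kerDeltaJ_le summable_kerDeltaJ)
open B5Kernel166Decay (torFin card_Tor_cast toT_sub chi_toT_eq_mFourier two_pi_rep_grid periodConst_pos)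
open B6LowerBound2153Torus (toT toT_rep)
open Beta.BlockEffectiveAction (DelK DelK_conjTranspose)
open B5Hk163Form166 (DelK_form_eq_formDk)
open B6Cov2156TorusDelK (isReal_DelK)
open B5RealFields (IsReal reM)

variable {d : ℕ}

/-! ## §1. Finite Fourier algebra (any dimension `d`): the entries of `Δ_k` are the inverse DFT of the symbol -/

section General

variable (n : ℕ) [NeZero n] (M : Fin d → ℕ) [hM : ∀ μ, NeZero (M μ)]

/-- THE TORUS KERNEL OF THE (μ,ν) ENTRY OF THE PRINTED SYMBOL: `K^T_{μν}(z) := |T|⁻¹ Σ_{p ∈ T̃} Δ̃_{j,μν}(p′) e^{ip′·z}`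
(inverse discrete Fourier transform over the dual torus, [B5] (1.29), of `symbDeltaJ n · μ ν`).
[cite: Balaban1987RG1, (4.40)–(4.41) p.291] -/
def torKer (μ ν : Fin d) (z : Tor M) : ℂ :=
  ((Fintype.card (Tor M) : ℂ))⁻¹ * ∑ p : Tor M, symbDeltaJ n (sOf M p) μ ν * chi M p z

omit [NeZero n] in
/-- the matrix symbol is Hermitian: `conj Δ̃_{j,μν}(p′) = Δ̃_{j,νμ}(p′)` (the weights of (1.66) are real and symmetric).
[cite: Balaban1987RG1, (4.41) p.291] -/
theorem conj_symbDeltaJ (s : Fin d → ℝ) (μ ν : Fin d) : conj (symbDeltaJ n s μ ν) = symbDeltaJ n s ν μ := by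
  have hw : w166 n μ ν s = w166 n ν μ s := by unfold w166; ring
  unfold symbDeltaJ symbW
  by_cases h : μ = ν
  · subst h
    simp only [if_true, map_sub, Complex.conj_ofReal, map_mul, Complex.conj_conj]
    ring
  · rw [if_neg h, if_neg (Ne.symm h), zero_sub, zero_sub, map_neg, map_mul, map_mul, Complex.conj_ofReal,
      Complex.conj_conj]
    beta_reduce
    rw [hw]
    ring

omit [NeZero n] in
/-- **the typed (1.66) as a complex identity**: `formDk n M B = Σ_p Σ_{μν} B̃_μ(p) Δ̃_{j,μν}(p′) conj B̃_ν(p)` (in `ℂ`; the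
fibrewise `polarization` of `B12Eq441SymbolExpansion`). [cite: Balaban1984PropagatorsI, (1.66) p.29] -/
theorem formDk_eq_symb_complex (B : Tor M × Fin d → ℂ) :
    ((formDk n M B : ℝ) : ℂ)
      = ∑ p, ∑ μ, ∑ ν, hat M B μ p * symbDeltaJ n (sOf M p) μ ν * conj (hat M B ν p) := by
  have hw : ∀ (s : Fin d → ℝ) (μ ν : Fin d), w166 n μ ν s = w166 n ν μ s := fun s μ ν => by unfold w166; ring
  have hcomm : ∀ g : Fin d → Fin d → Tor M → ℝ,
      ∑ μ, ∑ ν, ∑ p, g μ ν p = ∑ p, ∑ μ, ∑ ν, g μ ν p := by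
    intro g
    calc ∑ μ, ∑ ν, ∑ p, g μ ν p = ∑ μ, ∑ p, ∑ ν, g μ ν p :=
          Finset.sum_congr rfl fun μ _ => Finset.sum_comm
      _ = ∑ p, ∑ μ, ∑ ν, g μ ν p := Finset.sum_comm
  unfold formDk
  rw [hcomm, Finset.mul_sum]
  push_cast
  refine Finset.sum_congr rfl fun p _ => ?_
  have h := polarization (fun μ ν => w166 n μ ν (sOf M p)) (fun μ ν => hw (sOf M p) μ ν) (sOf M p)
    (fun ν => hat M B ν p)
  unfold symbDeltaJ
  rw [← h]
  push_cast
  rfl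

/-- the fibrewise multiplication by the TRANSPOSED symbol: `D_{(p,μ),(q,ν)} = δ_{pq} Δ̃_{j,νμ}(p′)`.
[cite: Balaban1987RG1, (4.41) p.291] -/
def symbMat : Matrix (Tor M × Fin d) (Tor M × Fin d) ℂ :=
  fun a b => if a.1 = b.1 then symbDeltaJ n (sOf M a.1) b.2 a.2 else 0

omit [NeZero n] in
/-- `(D u)(p,ν) = Σ_μ Δ̃_{j,μν}(p′) u(p,μ)`. [folklore] -/
private theorem symbMat_mulVec_apply (u : Tor M × Fin d → ℂ) (p : Tor M) (ν : Fin d) :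
    (symbMat n M *ᵥ u) (p, ν) = ∑ μ, symbDeltaJ n (sOf M p) μ ν * u (p, μ) := by
  classical
  simp only [Matrix.mulVec, dotProduct, symbMat]
  rw [Fintype.sum_prod_type, Finset.sum_eq_single p]
  · simp
  · intro q _ hq
    simp [Ne.symm hq]
  · intro h; exact absurd (Finset.mem_univ p) h

omit [NeZero n] in
/-- `uᴴ·D·u = Σ_p Σ_{μν} u(p,μ) Δ̃_{j,μν}(p′) conj u(p,ν)`. [folklore] -/
private theorem star_dotProduct_symbMat_mulVec (u : Tor M × Fin d → ℂ) :
    star u ⬝ᵥ (symbMat n M *ᵥ u) = ∑ p, ∑ μ, ∑ ν, u (p, μ) * symbDeltaJ n (sOf M p) μ ν * conj (u (p, ν)) := by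
  classical
  simp only [dotProduct, Pi.star_apply]
  rw [Fintype.sum_prod_type]
  refine Finset.sum_congr rfl fun p _ => ?_
  simp_rw [symbMat_mulVec_apply, Finset.mul_sum]
  rw [Finset.sum_comm]
  refine Finset.sum_congr rfl fun μ _ => Finset.sum_congr rfl fun ν _ => ?_
  rw [Complex.star_def]
  ring

/-- THE CANDIDATE MATRIX `K := Uᴴ·D·U` (`U` = the componentwise unitary DFT `dftV`): the operator whose matrix symbol
is the TRANSPOSED printed symbol. [cite: Balaban1987RG1, (4.40)–(4.41) p.291] -/
def kerMat : Matrix (Tor M × Fin d) (Tor M × Fin d) ℂ := (dftV M)ᴴ * symbMat n M * dftV M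

omit [NeZero n] in
/-- `Bᴴ·(Uᴴ w) = (U B)ᴴ·w`. [folklore] -/
private theorem star_dotProduct_conjTranspose_mulVec (U : Matrix (Tor M × Fin d) (Tor M × Fin d) ℂ)
    (B w : Tor M × Fin d → ℂ) : star B ⬝ᵥ (Uᴴ *ᵥ w) = star (U *ᵥ B) ⬝ᵥ w := by
  rw [Matrix.dotProduct_mulVec, Matrix.vecMul_conjTranspose, star_star]

omit [NeZero n] in
/-- `(U B)(p,μ) = B̃_μ(p)`. [folklore] -/
private theorem dftV_mulVec_eq_hat (B : Tor M × Fin d → ℂ) (p : Tor M) (μ : Fin d) :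
    (dftV M *ᵥ B) (p, μ) = hat M B μ p := by
  rw [dftV_mulVec_apply]
  rfl

omit [NeZero n] in
/-- **`Bᴴ·K·B = formDk n M B`** for every complex field `B` (unitarity bookkeeping + `formDk_eq_symb_complex`).
[cite: Balaban1984PropagatorsI, (1.66) p.29] -/
theorem star_dotProduct_kerMat_mulVec (B : Tor M × Fin d → ℂ) :
    star B ⬝ᵥ (kerMat n M *ᵥ B) = ((formDk n M B : ℝ) : ℂ) := by
  unfold kerMat
  rw [Matrix.mul_assoc, ← Matrix.mulVec_mulVec, star_dotProduct_conjTranspose_mulVec, ← Matrix.mulVec_mulVec,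
    star_dotProduct_symbMat_mulVec, formDk_eq_symb_complex]
  simp_rw [dftV_mulVec_eq_hat]

omit [NeZero n] in
/-- `(Uᴴ·A)_{(x,μ),b} = Σ_p conj dft(p,x) · A_{(p,μ),b}`. [folklore] -/
private theorem conjTranspose_dftV_mul_apply (A : Matrix (Tor M × Fin d) (Tor M × Fin d) ℂ) (x : Tor M) (μ : Fin d)
    (b : Tor M × Fin d) : ((dftV M)ᴴ * A) (x, μ) b = ∑ p, conj (dft M p x) * A (p, μ) b := by
  classical
  rw [Matrix.mul_apply, Fintype.sum_prod_type]
  refine Finset.sum_congr rfl fun p _ => ?_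
  rw [Finset.sum_eq_single μ]
  · rw [Matrix.conjTranspose_apply, dftV_apply, if_pos rfl, Complex.star_def]
  · intro κ _ hκ
    rw [Matrix.conjTranspose_apply, dftV_apply, if_neg hκ, star_zero, zero_mul]
  · intro h; exact absurd (Finset.mem_univ μ) h

omit [NeZero n] in
/-- `(A·U)_{a,(y,ν)} = Σ_q A_{a,(q,ν)} · dft(q,y)`. [folklore] -/
private theorem mul_dftV_apply (A : Matrix (Tor M × Fin d) (Tor M × Fin d) ℂ) (a : Tor M × Fin d) (y : Tor M)
    (ν : Fin d) : (A * dftV M) a (y, ν) = ∑ q, A a (q, ν) * dft M q y := by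
  classical
  rw [Matrix.mul_apply, Fintype.sum_prod_type]
  refine Finset.sum_congr rfl fun q _ => ?_
  rw [Finset.sum_eq_single ν]
  · rw [dftV_apply, if_pos rfl]
  · intro κ _ hκ
    rw [dftV_apply, if_neg hκ, mul_zero]
  · intro h; exact absurd (Finset.mem_univ ν) h

omit [NeZero n] in
/-- `conj dft(q,x) · dft(q,y) = |T|⁻¹ e^{iq·(x − y)}` (`B5Kernel166Decay.conj_dft_mul_dft`). [folklore] -/
private theorem conj_dft_mul_dft' (q x y : Tor M) :
    conj (dft M q x) * dft M q y = ((Fintype.card (Tor M) : ℂ))⁻¹ * chi M q (x - y) :=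
  B5Kernel166Decay.conj_dft_mul_dft M q x y

omit [NeZero n] in
/-- **THE ENTRIES OF `K`**: `K_{(x,μ),(y,ν)} = K^T_{νμ}(x − y) = |T|⁻¹ Σ_q Δ̃_{j,νμ}(p′_q) e^{ip′_q·(x−y)}`.
[cite: Balaban1987RG1, (4.40)–(4.41) p.291] -/
theorem kerMat_apply (x : Tor M) (μ : Fin d) (y : Tor M) (ν : Fin d) :
    kerMat n M (x, μ) (y, ν) = torKer n M ν μ (x - y) := by
  classical
  unfold kerMat torKer
  rw [mul_dftV_apply]
  simp_rw [conjTranspose_dftV_mul_apply]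
  have h1 : ∀ q : Tor M, (∑ p, conj (dft M p x) * symbMat n M (p, μ) (q, ν)) * dft M q y
      = ((Fintype.card (Tor M) : ℂ))⁻¹ * (symbDeltaJ n (sOf M q) ν μ * chi M q (x - y)) := by
    intro q
    rw [Finset.sum_eq_single q]
    · simp only [symbMat, if_true]
      rw [mul_right_comm, conj_dft_mul_dft']
      ring
    · intro p _ hp
      simp [symbMat, hp]
    · intro h; exact absurd (Finset.mem_univ q) h
  simp_rw [h1]
  rw [Finset.mul_sum]

omit [NeZero n] hM in
/-- complex polarization, matrix form: two complex matrices with the same quadratic form `v ↦ vᴴ·A·v` on ALL complex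
vectors are equal (Mathlib's `ext_inner_map` on `EuclideanSpace ℂ`). [folklore] -/
private theorem eq_of_forall_star_dotProduct_mulVec_eq {ι : Type*} [Fintype ι] [DecidableEq ι] (A C : Matrix ι ι ℂ)
    (h : ∀ v : ι → ℂ, star v ⬝ᵥ (A *ᵥ v) = star v ⬝ᵥ (C *ᵥ v)) : A = C := by
  have hq : ∀ v w : ι → ℂ, v ⬝ᵥ star w = star (star v ⬝ᵥ w) := by
    intro v w
    simp only [dotProduct, star_sum, star_mul, star_star, Pi.star_apply]
    exact Finset.sum_congr rfl fun i _ => mul_comm _ _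
  have key : Matrix.toEuclideanLin A = Matrix.toEuclideanLin C := by
    rw [← ext_inner_map]
    intro x
    obtain ⟨v, rfl⟩ : ∃ v : ι → ℂ, x = WithLp.toLp 2 v := ⟨WithLp.ofLp x, rfl⟩
    rw [Matrix.toLpLin_apply, Matrix.toLpLin_apply, WithLp.ofLp_toLp, EuclideanSpace.inner_toLp_toLp,
      EuclideanSpace.inner_toLp_toLp, hq, hq, h]
  exact Matrix.toEuclideanLin.injective key

/-- **Δ_k = K**: the (1.65) operator of record `Beta.BlockEffectiveAction.DelK` (for every admissible `a`) is the
matrix `Uᴴ·D·U` — both have the quadratic form `formDk` on every complex field (`B5Hk163Form166.DelK_form_eq_formDk`,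
`star_dotProduct_kerMat_mulVec`), and a complex matrix is determined by its quadratic form.
[cite: Balaban1987RG1, (4.40) p.291] [cite: Balaban1984PropagatorsI, (1.65)–(1.66) p.29] -/
theorem DelK_eq_kerMat (hn : 1 ≤ n) (a : ℝ) (ha : 0 < a) : DelK n hn M a ha = kerMat n M := by
  classical
  refine eq_of_forall_star_dotProduct_mulVec_eq _ _ fun B => ?_
  rw [DelK_form_eq_formDk, star_dotProduct_kerMat_mulVec]

/-- **THE ENTRIES OF `Δ_k` — (4.40) with «the function Δ_{j,μν}(x − y) in the momentum representation»**:
`(Δ_k)_{(x,μ),(y,ν)} = K^T_{νμ}(x − y) = |T|⁻¹ Σ_q Δ̃_{j,νμ}(p′_q) e^{ip′_q·(x − y)}` for every admissible `a`, every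
`n = L^j ≥ 1`, every torus. (Index order: with [B5] (1.29) `f̃(p) = Σ_x e^{−ip·x}f(x)` the symbol `σ` of `Δ_k` in the
sense `(Δ_kB)~_μ = Σ_ν σ_{μν}B̃_ν` is the transpose `Δ̃_{j,νμ} = conj Δ̃_{j,μν}` of the printed (4.41) matrix — immaterial
for the quadratic form, see `DelK_apply'`.) [cite: Balaban1987RG1, (4.40)–(4.41) p.291] -/
theorem DelK_apply (hn : 1 ≤ n) (a : ℝ) (ha : 0 < a) (x : Tor M) (μ : Fin d) (y : Tor M) (ν : Fin d) :
    DelK n hn M a ha (x, μ) (y, ν) = torKer n M ν μ (x - y) := by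
  rw [DelK_eq_kerMat, kerMat_apply]

omit [NeZero n] in
/-- `conj K^T_{μν}(z) = K^T_{νμ}(−z)` (Hermitian symbol). [cite: Balaban1987RG1, (4.41) p.291] -/
theorem conj_torKer (μ ν : Fin d) (z : Tor M) : conj (torKer n M μ ν z) = torKer n M ν μ (-z) := by
  unfold torKer
  rw [map_mul, map_inv₀, Complex.conj_natCast, map_sum]
  congr 1
  refine Finset.sum_congr rfl fun p _ => ?_
  rw [map_mul, conj_symbDeltaJ, conj_chi, B5Kernel166Decay.chi_neg_comm]

/-! ### §1b. Consequences: reality, symmetry, the (1.19) operator of record, the quadratic form (4.40) -/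

/-- **THE TORUS KERNEL IS REAL**: `Im K^T_{μν}(z) = 0` — the (1.65) operator is a real matrix
(`B6Cov2156TorusDelK.isReal_DelK`). [cite: Balaban1987RG1, (4.40) p.291] -/
theorem torKer_im (μ ν : Fin d) (z : Tor M) : (torKer n M μ ν z).im = 0 := by
  have hn : 1 ≤ n := Nat.one_le_iff_ne_zero.mpr (NeZero.ne n)
  have h := (isReal_DelK n hn M 1 one_pos).im_eq_zero (z, ν) ((0 : Tor M), μ)
  rwa [DelK_apply, sub_zero] at h

/-- `conj K^T_{μν}(z) = K^T_{μν}(z)` (real kernel). [cite: Balaban1987RG1, (4.40) p.291] -/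
theorem conj_torKer_eq_self (μ ν : Fin d) (z : Tor M) : conj (torKer n M μ ν z) = torKer n M μ ν z :=
  Complex.conj_eq_iff_im.mpr (torKer_im n M μ ν z)

/-- `K^T_{μν}(z) = (Re K^T_{μν}(z) : ℂ)` (real kernel). [cite: Balaban1987RG1, (4.40) p.291] -/
theorem torKer_eq_ofReal_re (μ ν : Fin d) (z : Tor M) : torKer n M μ ν z = (((torKer n M μ ν z).re : ℝ) : ℂ) :=
  (Complex.conj_eq_iff_re.mp (conj_torKer_eq_self n M μ ν z)).symm

/-- **symmetry of the kernel**: `K^T_{μν}(z) = K^T_{νμ}(−z)` (Hermitian symbol + reality: the (1.65) operator is real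
symmetric). [cite: Balaban1987RG1, (4.40) p.291] -/
theorem torKer_symm (μ ν : Fin d) (z : Tor M) : torKer n M μ ν z = torKer n M ν μ (-z) := by
  rw [← conj_torKer, conj_torKer_eq_self]

/-- entries of `Δ_k`, second form: `(Δ_k)_{(x,μ),(y,ν)} = K^T_{μν}(y − x)`. [cite: Balaban1987RG1, (4.40)–(4.41) p.291] -/
theorem DelK_apply' (hn : 1 ≤ n) (a : ℝ) (ha : 0 < a) (x : Tor M) (μ : Fin d) (y : Tor M) (ν : Fin d) :
    DelK n hn M a ha (x, μ) (y, ν) = torKer n M μ ν (y - x) := by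
  rw [DelK_apply, torKer_symm, neg_sub]

end General

section Gaussian

variable (L : ℕ) [NeZero L] (M : Fin d → ℕ) [hM : ∀ μ, NeZero (M μ)]

/-- **THE (1.19) OPERATOR OF RECORD ACTS BY CONVOLUTION WITH THE TORUS KERNEL**: for the Gaussian covariance
`Δ_k = B5Eq114Gauss.DeltaK L M k` of the k-fold renormalization integral (1.17)/(1.19) (= the (1.65) operator,
`B5Eq166GaussDeltaK.cplx_DeltaK`) and every real unit-lattice field `B`,
`(Δ_kB)(x,μ) = Σ_{y,ν} K^T_{νμ}(x − y) B(y,ν)` (`n = L^k`; the kernel is real, `torKer_im`).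
[cite: Balaban1987RG1, (4.40) p.291] [cite: Balaban1984PropagatorsI, (1.19) p.20, (1.65) p.29] -/
theorem DeltaK_apply_eq_sum (k : ℕ) (B : B5SectBStatements.Fld M) (x : Tor M) (μ : Fin d) :
    B5Eq114Gauss.DeltaK L M k B (x, μ) = ∑ y, ∑ ν, (torKer (L ^ k) M ν μ (x - y)).re * B (y, ν) := by
  have hn : 1 ≤ L ^ k := Nat.one_le_pow _ _ (Nat.pos_of_ne_zero (NeZero.ne L))
  haveI : NeZero (L ^ k) := ⟨by omega⟩
  rw [B5Eq166GaussDeltaK.DeltaK_apply L M k hn 1 one_pos]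
  show (reM (DelK (L ^ k) hn M 1 one_pos) *ᵥ WithLp.ofLp B) (x, μ) = _
  simp only [Matrix.mulVec, dotProduct, B5RealFields.reM_apply]
  rw [Fintype.sum_prod_type]
  refine Finset.sum_congr rfl fun y _ => Finset.sum_congr rfl fun ν _ => ?_
  rw [DelK_apply]

/-- **(4.40) ON THE TORUS, QUADRATIC FORM**: `⟨B, Δ_kB⟩ = Σ_{x,μ} Σ_{y,ν} B(x,μ) K^T_{νμ}(x − y) B(y,ν)` for every real
field `B` on the unit torus (the (1.19)/(1.65) operator of record; `K^T` = inverse DFT of the printed symbol (4.41)).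
[cite: Balaban1987RG1, (4.40) p.291] [cite: Balaban1984PropagatorsI, (1.65) p.29] -/
theorem inner_DeltaK_eq_sum (k : ℕ) (B : B5SectBStatements.Fld M) :
    ⟪B, B5Eq114Gauss.DeltaK L M k B⟫_ℝ
      = ∑ x, ∑ μ, ∑ y, ∑ ν, B (x, μ) * (torKer (L ^ k) M ν μ (x - y)).re * B (y, ν) := by
  have h1 : ⟪B, B5Eq114Gauss.DeltaK L M k B⟫_ℝ = ∑ a, B a * B5Eq114Gauss.DeltaK L M k B a := by
    simp only [PiLp.inner_apply, RCLike.inner_apply, conj_trivial]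
    exact Finset.sum_congr rfl fun a _ => mul_comm _ _
  rw [h1, Fintype.sum_prod_type]
  refine Finset.sum_congr rfl fun x _ => Finset.sum_congr rfl fun μ _ => ?_
  rw [DeltaK_apply_eq_sum, Finset.mul_sum]
  refine Finset.sum_congr rfl fun y _ => ?_
  rw [Finset.mul_sum]
  exact Finset.sum_congr rfl fun ν _ => by ring

/-- **(4.40) «⟨∂^ξH_j, ∂^ξH_j⟩ = Δ_j» ON THE TORUS**: for the Landau-gauge minimiser `A = H_kB` of record
(`A ∈ B5Eq165DeltaK.landauMin L M k B`, [B5] (1.63)/(1.65)), `2·S^η(A) = ⟨∂A, ∂A⟩` equals the kernel form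
`Σ_{x,μ}Σ_{y,ν} B(x,μ) K^T_{νμ}(x − y) B(y,ν)` of the inverse DFT of the printed symbol (4.41)
(`B5Eq165DeltaK.eq165` + `inner_DeltaK_eq_sum`). [cite: Balaban1987RG1, (4.40) p.291]
[cite: Balaban1984PropagatorsI, (1.65) p.29] -/
theorem eq440_torus (k : ℕ) {B : B5SectBStatements.Fld M}
    {A : B5SectBStatements.Fld (B5SectBStatements.towerM L M k)} (hA : A ∈ B5Eq165DeltaK.landauMin L M k B) :
    2 * B5SectBStatements.actionEta L M k A
      = ∑ x, ∑ μ, ∑ y, ∑ ν, B (x, μ) * (torKer (L ^ k) M ν μ (x - y)).re * B (y, ν) := by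
  rw [← B5Eq165DeltaK.eq165 L M k hA, inner_DeltaK_eq_sum]

end Gaussian

/-! ## §2. Dimension `d + 1`: the torus kernel IS the periodised `ℤ^{d+1}`-kernel `Δ_{j,μν}` of (4.41) -/

section Periodise

variable (n : ℕ) [NeZero n] (M : Fin (d + 1) → ℕ) [hM : ∀ μ, NeZero (M μ)]

/-- the strip datum of the continued entries (`B12Eq443LatticeMoments.stripRegular_symbC`). [folklore] -/
private theorem reg (μ ν : Fin (d + 1)) :
    StripRegular (d := d) (symbC n μ ν) (kappa166 (d + 1)) (MC (d + 1) (kappa166 (d + 1))) :=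
  stripRegular_symbC n μ ν (kappa166_pos _).le le_rfl

omit [NeZero n] in
/-- all periods are `≥ 1`. [folklore] -/
private theorem one_le_M' : ∀ i, 1 ≤ M i := fun _ => Nat.one_le_iff_ne_zero.mpr (NeZero.ne _)

/-- the two momentum conventions on the grid (`2π rep(t_i/M_i) ∈ [−π,π)` of the torus-kernel engine versus
`p′ = sOf ∈ (−π,π]` of (1.29)) give the same value of the continued entry (face matching for a strip-regular
multiplier; pattern `B5Kernel166Decay.Gsym_grid_eq`). [cite: Balaban1984PropagatorsI, (1.29) p.23] -/
theorem symbC_grid_eq (μ ν : Fin (d + 1)) (t : Tor M) :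
    symbC n μ ν (ofRealVec (fun i => 2 * Real.pi *
        B4TorusKernel.rep ((((torFin M t i : ℕ) : ℝ) / M i : ℝ) : UnitAddCircle)))
      = symbC n μ ν (ofRealVec (sOf M t)) := by
  classical
  set u : Fin (d + 1) → ℝ :=
    fun i => 2 * Real.pi * B4TorusKernel.rep ((((torFin M t i : ℕ) : ℝ) / M i : ℝ) : UnitAddCircle) with hu_def
  have hdich : ∀ i, u i = sOf M t i ∨ (u i = -Real.pi ∧ sOf M t i = Real.pi) := fun i => two_pi_rep_grid M t i
  have hu : u ∈ BZ (d + 1) := by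
    refine ⟨fun i => ?_, fun i => ?_⟩
    · have h := (rep_mem (((((torFin M t i : ℕ) : ℝ) / M i : ℝ) : UnitAddCircle))).1
      show -Real.pi ≤ 2 * Real.pi * _
      nlinarith [Real.pi_pos]
    · have h := (rep_mem (((((torFin M t i : ℕ) : ℝ) / M i : ℝ) : UnitAddCircle))).2
      show 2 * Real.pi * _ ≤ Real.pi
      nlinarith [Real.pi_pos]
  have hv : sOf M t ∈ BZ (d + 1) :=
    ⟨fun i => (abs_le.mp (abs_sOf_le M t i)).1, fun i => (abs_le.mp (abs_sOf_le M t i)).2⟩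
  refine face_match (reg n μ ν) (kappa166_pos _).le (Finset.univ.filter fun i => u i ≠ sOf M t i)
    u (sOf M t) hu hv (fun i hi => ?_) (fun i hi => ?_)
  · by_contra h
    exact hi (Finset.mem_filter.mpr ⟨Finset.mem_univ _, h⟩)
  · have h := (Finset.mem_filter.mp hi).2
    rcases hdich i with h' | h'
    · exact absurd h' h
    · exact h'

/-- **THE TORUS KERNEL IS THE ENGINE'S TORUS KERNEL OF THE DESCENDED SYMBOL**: at the class of `x ∈ ℤ^{d+1}`,
`K^T_{μν}(x̄) = MultiPeriod.torusKernel (descendC Δ̃ᶜ_{j,μν}) M x`. [cite: Balaban1984PropagatorsI, (1.29) p.23, p.36 ll.20–23] -/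
theorem torKer_toT_eq_torusKernel (μ ν : Fin (d + 1)) (x : Fin (d + 1) → ℤ) :
    torKer n M μ ν (toT M x) = torusKernel (descendC (symbC n μ ν) (reg n μ ν) (kappa166_pos _).le) M x := by
  unfold torKer torusKernel torusSum
  rw [card_Tor_cast]
  congr 1
  refine Fintype.sum_equiv (torFin M) _ _ fun t => ?_
  rw [descendC_apply, B4TorusKernel.MultiPeriod.descend_gridPt, chi_toT_eq_mFourier, symbC_grid_eq,
    symbC_ofReal n μ ν (sOf M t) (abs_sOf_le M t)]

/-- **THE TORUS KERNEL IS THE PERIODISED `ℤ^{d+1}`-KERNEL OF (4.41)** (Poisson summation,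
`B4TorusKernel.MultiPeriod.torusKernel_descend_eq`): for every `x ∈ ℤ^{d+1}`,
`K^T_{μν}(x̄) = Σ_{m ∈ ℤ^{d+1}} Δ_{j,μν}(x + (M_im_i)_i)`, `Δ_{j,μν} = B12Eq443LatticeMoments.kerDeltaJ n μ ν` (the
kernel `(2π)^{−(d+1)}∫Δ̃_{j,μν}(p′)e^{ip′·x}dp′` of the printed momentum representation), every `n = L^j ≥ 1`, every
period vector. [cite: Balaban1987RG1, (4.40)–(4.41) p.291] [cite: Balaban1984PropagatorsI, p.36 ll.20–23] -/
theorem torKer_toT_eq_tsum (μ ν : Fin (d + 1)) (x : Fin (d + 1) → ℤ) :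
    torKer n M μ ν (toT M x) = ∑' m : Fin (d + 1) → ℤ, kerDeltaJ n μ ν (translate M x m) := by
  rw [torKer_toT_eq_torusKernel, torusKernel_descend_eq (reg n μ ν) (kappa166_pos _) (one_le_M' M) x]
  rfl

/-- absolute convergence of the periodisation at a centred representative (`2|x_i| ≤ M_i`).
[cite: Balaban1984PropagatorsI, p.36 ll.20–23] -/
theorem summable_kerDeltaJ_translate (μ ν : Fin (d + 1)) (x : Fin (d + 1) → ℤ) (hx : ∀ i, 2 * |x i| ≤ M i) :
    Summable (fun m : Fin (d + 1) → ℤ => kerDeltaJ n μ ν (translate M x m)) :=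
  (B4TorusKernel.MultiPeriod.periodise_bound (kerDeltaJ n μ ν) (kappa166_pos _) (norm_kerDeltaJ_le n μ ν)
    (one_le_M' M) x hx).1

/-- **THE ENTRIES OF `Δ_k` AS A LATTICE SUM**: `(Δ_k)_{(x̄,μ),(ȳ,ν)} = Σ_{m ∈ ℤ^{d+1}} Δ_{j,νμ}(x − y + (M_im_i)_i)` for all
representatives `x, y ∈ ℤ^{d+1}`, every admissible `a`, every `n = L^j ≥ 1`, every torus — the (1.65) operator of
record IS the periodisation of the `ℤ^{d+1}` operator `Δ_j` of (4.40)/(4.41).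
[cite: Balaban1987RG1, (4.40)–(4.41) p.291] -/
theorem DelK_apply_eq_tsum (hn : 1 ≤ n) (a : ℝ) (ha : 0 < a) (x y : Fin (d + 1) → ℤ) (μ ν : Fin (d + 1)) :
    DelK n hn M a ha (toT M x, μ) (toT M y, ν) = ∑' m : Fin (d + 1) → ℤ, kerDeltaJ n ν μ (translate M (x - y) m) := by
  rw [DelK_apply, toT_sub, torKer_toT_eq_tsum]

/-- the same in the second index order: `(Δ_k)_{(x̄,μ),(ȳ,ν)} = Σ_m Δ_{j,μν}(y − x + (M_im_i)_i)`.
[cite: Balaban1987RG1, (4.40)–(4.41) p.291] -/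
theorem DelK_apply_eq_tsum' (hn : 1 ≤ n) (a : ℝ) (ha : 0 < a) (x y : Fin (d + 1) → ℤ) (μ ν : Fin (d + 1)) :
    DelK n hn M a ha (toT M x, μ) (toT M y, ν) = ∑' m : Fin (d + 1) → ℤ, kerDeltaJ n μ ν (translate M (y - x) m) := by
  rw [DelK_apply', toT_sub, torKer_toT_eq_tsum]

end Periodise

/-! ## §3. p. 290 «we extend summations over y to the whole lattice Z⁴»: the torus kernel of `Δ_k` IS the
`ℤ^{d+1}`-kernel `Δ_{j,μν}` of (4.41) up to an exponentially small periodisation tail, uniformly in `j` -/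

section Tail

variable (n : ℕ) [NeZero n] (M : Fin (d + 1) → ℕ) [hM : ∀ μ, NeZero (M μ)]

omit hM in
/-- a non-zero translate of a centred point is far: `R ≤ M_i`, `2|x_i| ≤ M_i`, `m ≠ 0` ⇒ `|x + Mm|_∞ ≥ R/2`. [folklore] -/
private theorem half_le_supNorm_translate {R : ℕ} (hR : ∀ i, R ≤ M i) (x : Fin (d + 1) → ℤ)
    (hx : ∀ i, 2 * |x i| ≤ M i) {m : Fin (d + 1) → ℤ} (hm : m ≠ 0) :
    (R : ℝ) / 2 ≤ supNorm (translate M x m) := by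
  obtain ⟨i, hi⟩ := Function.ne_iff.mp hm
  have hmi : 1 ≤ |m i| := Int.one_le_abs hi
  have hMi : (M i : ℤ) ≤ (M i : ℤ) * |m i| := le_mul_of_one_le_right (by positivity) hmi
  have habs : (M i : ℤ) * |m i| = |(M i : ℤ) * m i| := by rw [abs_mul, abs_of_nonneg (by positivity : (0 : ℤ) ≤ M i)]
  have htri : |(M i : ℤ) * m i| ≤ |x i + M i * m i| + |x i| := by
    calc |(M i : ℤ) * m i| = |(x i + M i * m i) - x i| := by ring_nf
      _ ≤ |x i + M i * m i| + |x i| := abs_sub _ _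
  have h1 : (M i : ℤ) ≤ 2 * |x i + M i * m i| := by linarith [hx i]
  have h2 : ((R : ℤ) : ℝ) ≤ 2 * ((|translate M x m i| : ℤ) : ℝ) := by
    have : (R : ℤ) ≤ 2 * |translate M x m i| := by
      rw [B4TorusKernel.MultiPeriod.translate_apply]; have := hR i; omega
    exact_mod_cast this
  have h3 := abs_le_supNorm (translate M x m) i
  have h4 : ((R : ℤ) : ℝ) = (R : ℝ) := by norm_cast
  rw [h4] at h2
  linarith

/-- **TORUS KERNEL = LATTICE KERNEL + EXPONENTIALLY SMALL TAIL**: if every period is `≥ R` and `x` is a representative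
with `2|x|_∞ < R`, then `‖K^T_{μν}(x̄) − Δ_{j,μν}(x)‖ ≤ MC · e^{−κ₁₆₆R/4} · periodConst(κ₁₆₆/2, d)` — constants depending
on `d` only, uniform in `n = L^j ≥ 1` and in the torus (the `m ≠ 0` terms of the periodisation, each at sup-distance
`≥ R/2`, through `B4TorusKernel.MultiPeriod.periodise_bound`). The p. 290 passage to «the whole lattice Z⁴» costs
«exponentially small coefficients». [cite: Balaban1987RG1, p.290 ll.23–25, (4.36) p.290, (4.37)–(4.40) p.291] -/
theorem norm_torKer_toT_sub_kerDeltaJ_le {R : ℕ} (hR : ∀ i, R ≤ M i) (μ ν : Fin (d + 1)) (x : Fin (d + 1) → ℤ)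
    (hx : 2 * supNorm x < R) :
    ‖torKer n M μ ν (toT M x) - kerDeltaJ n μ ν x‖
      ≤ MC (d + 1) (kappa166 (d + 1)) * Real.exp (-(kappa166 (d + 1) * R / 4))
          * periodConst (kappa166 (d + 1) / 2) d := by
  classical
  set κ : ℝ := kappa166 (d + 1) with hκ
  have hκ0 : 0 < κ := kappa166_pos _
  set K : (Fin (d + 1) → ℤ) → ℂ := kerDeltaJ n μ ν with hK
  -- the centring hypothesis coordinatewise
  have hxc : ∀ i, 2 * |x i| ≤ (M i : ℤ) := by
    intro i
    have h1 := abs_le_supNorm x i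
    have h2 : (2 * |x i| : ℝ) < R := by push_cast at h1 ⊢; linarith
    have h3 : 2 * |x i| < (R : ℤ) := by exact_mod_cast h2
    have := hR i
    omega
  -- the tail function: the kernel beyond sup-distance R/2
  set K' : (Fin (d + 1) → ℤ) → ℂ := fun y => if (R : ℝ) / 2 ≤ supNorm y then K y else 0 with hK'
  have hK'b : ∀ y, ‖K' y‖ ≤ MC (d + 1) κ * Real.exp (-(κ * R / 4)) * Real.exp (-(κ / 2 * supNorm y)) := by
    intro y
    by_cases hy : (R : ℝ) / 2 ≤ supNorm y
    · rw [hK']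
      simp only [hy, if_true]
      have h1 : ‖K y‖ ≤ MC (d + 1) κ * Real.exp (-(κ * supNorm y)) := norm_kerDeltaJ_le n μ ν y
      have hMC : 0 ≤ MC (d + 1) κ := by unfold MC; have := MW_pos (d + 1); positivity
      have h2 : Real.exp (-(κ * supNorm y)) ≤ Real.exp (-(κ * R / 4)) * Real.exp (-(κ / 2 * supNorm y)) := by
        rw [← Real.exp_add]
        exact Real.exp_le_exp.mpr (by nlinarith)
      calc ‖K y‖ ≤ MC (d + 1) κ * Real.exp (-(κ * supNorm y)) := h1
        _ ≤ MC (d + 1) κ * (Real.exp (-(κ * R / 4)) * Real.exp (-(κ / 2 * supNorm y))) :=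
            mul_le_mul_of_nonneg_left h2 hMC
        _ = _ := by ring
    · rw [hK']
      simp only [hy, if_false, norm_zero]
      have hMC : 0 ≤ MC (d + 1) κ := by unfold MC; have := MW_pos (d + 1); positivity
      positivity
  obtain ⟨hsK', hbK'⟩ := B4TorusKernel.MultiPeriod.periodise_bound K' (half_pos hκ0) hK'b (one_le_M' M) x hxc
  -- termwise: K'(x + Mm) = K(x + Mm) − [m = 0]·K(x)
  have hterm : ∀ m : Fin (d + 1) → ℤ, K' (translate M x m) = K (translate M x m) - if m = 0 then K x else 0 := by
    intro m
    by_cases hm : m = 0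
    · subst hm
      have hx0 : translate M x 0 = x := by funext i; simp [B4TorusKernel.MultiPeriod.translate_apply]
      have hlt : ¬ ((R : ℝ) / 2 ≤ supNorm x) := by push Not; linarith
      simp [hK', hx0, hlt]
    · have hfar := half_le_supNorm_translate M hR x hxc hm
      simp [hK', hfar, hm]
  have hsK : Summable (fun m : Fin (d + 1) → ℤ => K (translate M x m)) := summable_kerDeltaJ_translate n M μ ν x hxc
  have hsum : ∑' m : Fin (d + 1) → ℤ, K' (translate M x m) = (∑' m : Fin (d + 1) → ℤ, K (translate M x m)) - K x := by
    simp_rw [hterm]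
    rw [Summable.tsum_sub hsK (summable_of_ne_finset_zero (s := {0}) (fun m hm => by
      rw [Finset.mem_singleton] at hm; simp [hm])), tsum_ite_eq]
  rw [torKer_toT_eq_tsum, ← hK, ← hsum]
  refine hbK'.trans ?_
  have hP : 0 < periodConst (κ / 2) d := periodConst_pos (half_pos hκ0) d
  have hMC : 0 ≤ MC (d + 1) κ * Real.exp (-(κ * R / 4)) := by
    have : 0 ≤ MC (d + 1) κ := by unfold MC; have := MW_pos (d + 1); positivity
    positivity
  have hE : Real.exp (-(κ / 2 / (d + 1) * ∑ i, |((x i : ℤ) : ℝ)|)) ≤ 1 := by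
    rw [Real.exp_le_one_iff]
    have : 0 ≤ ∑ i, |((x i : ℤ) : ℝ)| := Finset.sum_nonneg fun i _ => abs_nonneg _
    have : 0 ≤ κ / 2 / (d + 1) := by positivity
    nlinarith
  calc MC (d + 1) κ * Real.exp (-(κ * R / 4)) * periodConst (κ / 2) d *
        Real.exp (-(κ / 2 / (d + 1) * ∑ i, |((x i : ℤ) : ℝ)|))
      ≤ MC (d + 1) κ * Real.exp (-(κ * R / 4)) * periodConst (κ / 2) d * 1 :=
        mul_le_mul_of_nonneg_left hE (mul_nonneg hMC hP.le)
    _ = _ := by ring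

/-- **(4.40) ON THE TORUS VERSUS (4.41) ON `ℤ^{d+1}`**: for representatives at torus sup-distance `< R/2` (`R` = the
smallest period), the entry of the (1.65) operator differs from the `ℤ^{d+1}`-kernel `Δ_{j,νμ}(x − y)` by at most
`MC · e^{−κ₁₆₆R/4} · periodConst(κ₁₆₆/2, d)` — uniformly in `n = L^j`, every admissible `a`.
[cite: Balaban1987RG1, p.290, (4.40)–(4.41) p.291] -/
theorem norm_DelK_sub_kerDeltaJ_le (hn : 1 ≤ n) (a : ℝ) (ha : 0 < a) {R : ℕ} (hR : ∀ i, R ≤ M i)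
    (x y : Fin (d + 1) → ℤ) (μ ν : Fin (d + 1)) (hxy : 2 * supNorm (x - y) < R) :
    ‖DelK n hn M a ha (toT M x, μ) (toT M y, ν) - kerDeltaJ n ν μ (x - y)‖
      ≤ MC (d + 1) (kappa166 (d + 1)) * Real.exp (-(kappa166 (d + 1) * R / 4))
          * periodConst (kappa166 (d + 1) / 2) d := by
  rw [DelK_apply, toT_sub]
  exact norm_torKer_toT_sub_kerDeltaJ_le n M hR ν μ (x - y) hxy

end Tail


end Literature.MathematicalPhysics.QuantumFieldTheory.Balaban1983to89.B12Eq440TorusKernel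

end
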